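import Literature.Probability.Percolation.TwoClusterConditionalAssociationProofs
import Literature.Probability.Percolation.PercolationEvents
import Literature.Probability.LatticeModels.ProdBernoulliIndependence
import Mathlib.Tactic.Linarith
import HarnessLib

/-!
# Cross-Harris at a terminal: the Harris inequality for `{a ↔ b}`, `{a ↔ c}` is superadditive over the boundary law of `b`

Support file for `stmt-CriticalPhenomena-4575` (memo `prim-gen-kcluster/KCLUSTER-gen66.md` §3.7; prover
prim-gen-kcluster gen 66).  No named facts, no sorries, no new definitions.

SETTING.  Bond percolation with arbitrary edge probabilities on a finite vertex type `V`
(`μ = prodBernoulli w` on `BondConfig V = Set (Sym2 V)`), vertices `a, c` and two vertex sets `X, X'`.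
Think of `V` as the vertex set of `K = G − b` for a graph `G` with one further vertex `b` (a "terminal"), and
of `X ⊆ V` as the set of neighbours of `b` joined to `b` by OPEN edges (the *pattern* of the star of `b`).
Given the pattern `X`, connections of `G` are connections of `K` with `X` glued through `b`; writing
`R_a(X) := ⋃ x ∈ X, {a ↔ x}` ("the open cluster of `a` meets `X`"):
* `B_X := {a ↔ b} = R_a(X)`,
* `C_X := {a ↔ c in G} = {a ↔ c} ∪ (R_a(X) ∩ R_c(X))`   (through `K`, or through `b`),
* `A_X := {a ↔ b ↔ c} = R_a(X) ∩ ({a ↔ c} ∪ R_c(X))`.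
For the true (product) law `π` of the pattern, the Harris slack `μ{a↔b↔c} − μ{a↔b}μ{a↔c}` of `G` is the
quadratic form `½ Σ_{X,X'} π(X)π(X') CH[X,X']` with the polar form
`CH[X,X'] = μ(A_X) + μ(A_{X'}) − μ(B_X)·μ(C_{X'}) − μ(B_{X'})·μ(C_X)`.

**Theorem** (`CrossHarris.crossHarris_terminal`): `CH[X,X'] ≥ 0` for ALL pairs of vertex sets `X, X'`:
`μ(B_X)·μ(C_{X'}) + μ(B_{X'})·μ(C_X) ≤ μ(A_X) + μ(A_{X'})`.
Consequently (`CrossHarris.harris_terminal_potential`) the Harris inequality for `{a↔b}`, `{a↔c}` holds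
for every mixture `Σ_X ψ_X μ(· ∩ {pattern X})` with ARBITRARY non-negative weights `ψ` — i.e. it survives
an arbitrary non-negative potential on the star of the terminal `b` (the matrix `CH` is entrywise
non-negative, hence copositive).  This is the `q = 1`, Harris instance of the 'terminal-star
cross-positivity' phenomenon of the memo (for the refined row R1 the analogous statement is conjecture
TSC, census 0 / 1.47·10⁸ pattern pairs; the analogous statements at the apex `a` or at an interior vertex
are false already for Harris).

Proof.  `A_X = (B_X ∩ C) ⊔ (B_X ∩ E_X ∩ Cᶜ)` and `C_{X'} = C ⊔ (B_{X'} ∩ E_{X'} ∩ Cᶜ)` with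
`C = {a ↔ c}`, `E_X = R_c(X)`; Harris (`prodBernoulli_harris`) gives `μ(B_X ∩ C) ≥ μ(B_X)μ(C)`, and the
two remaining products are bounded using `μ(B) ≤ 1`:
`CH = [μ(B_X∩C) − μ(B_X)μ(C)] + [μ(B_{X'}∩C) − μ(B_{X'})μ(C)] + (1 − μ(B_{X'}))·μ(B_X∩E_X∩Cᶜ) + (1 − μ(B_X))·μ(B_{X'}∩E_{X'}∩Cᶜ) ≥ 0`.
[this work]
-/

noncomputable section

namespace Summit.CriticalPhenomena.PercolationContinuityZ3.Theorems

namespace CrossHarris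

open MeasureTheory Literature.Probability.Percolation Literature.Probability.LatticeModels

variable {V : Type*} [Fintype V]

omit [Fintype V] in
/-- The event "the open cluster of `a` meets the vertex set `X`", `⋃ x ∈ X, {a ↔ x}`, is increasing.
[folklore] -/
theorem isUpperSet_reach (a : V) (X : Set V) :
    IsUpperSet (⋃ x ∈ X, (openConn a x : Set (BondConfig V))) :=
  isUpperSet_iUnion₂ fun x _ => isUpperSet_openConn a x

/-- Splitting an event along `C`: `μ(B ∩ (C ∪ E)) = μ(B ∩ C) + μ(B ∩ E ∩ Cᶜ)`. [folklore] -/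
theorem real_inter_union_split (μ : Measure (BondConfig V)) [IsFiniteMeasure μ]
    (B C E : Set (BondConfig V)) :
    μ.real (B ∩ (C ∪ E)) = μ.real (B ∩ C) + μ.real (B ∩ E ∩ Cᶜ) := by
  have hset : B ∩ (C ∪ E) = (B ∩ C) ∪ (B ∩ E ∩ Cᶜ) := by
    ext ω
    simp only [Set.mem_inter_iff, Set.mem_union, Set.mem_compl_iff]
    tauto
  have hdisj : Disjoint (B ∩ C) (B ∩ E ∩ Cᶜ) := by
    rw [Set.disjoint_left]
    rintro ω ⟨-, hC⟩ ⟨-, hnC⟩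
    exact hnC hC
  rw [hset, measureReal_union hdisj MeasurableSet.of_discrete]

/-- Splitting `C ∪ (B ∩ E)`: `μ(C ∪ (B ∩ E)) = μ(C) + μ(B ∩ E ∩ Cᶜ)`. [folklore] -/
theorem real_union_inter_split (μ : Measure (BondConfig V)) [IsFiniteMeasure μ]
    (B C E : Set (BondConfig V)) :
    μ.real (C ∪ (B ∩ E)) = μ.real C + μ.real (B ∩ E ∩ Cᶜ) := by
  have hset : C ∪ (B ∩ E) = C ∪ (B ∩ E ∩ Cᶜ) := by
    ext ω
    simp only [Set.mem_inter_iff, Set.mem_union, Set.mem_compl_iff]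
    tauto
  have hdisj : Disjoint C (B ∩ E ∩ Cᶜ) := by
    rw [Set.disjoint_left]
    rintro ω hC ⟨-, hnC⟩
    exact hnC hC
  rw [hset, measureReal_union hdisj MeasurableSet.of_discrete]

/-- The algebraic core: from Harris for `(B, C)` and `(B', C)`, `μ(B), μ(B') ≤ 1` and non-negativity of the
two remainder cells, the cross inequality follows. [this work] -/
theorem cross_of_cells {b b' k s s' r r' : ℝ} (h1 : b * k ≤ s) (h2 : b' * k ≤ s') (hb : b ≤ 1)
    (hb' : b' ≤ 1) (hr : 0 ≤ r) (hr' : 0 ≤ r') :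
    b * (k + r') + b' * (k + r) ≤ (s + r) + (s' + r') := by
  have h3 : b * r' ≤ r' := mul_le_of_le_one_left hr' hb
  have h4 : b' * r ≤ r := mul_le_of_le_one_left hr hb'
  nlinarith [h1, h2, h3, h4]

/-- **Cross-Harris at a terminal.**  For every finite weighted graph (`prodBernoulli w` on `BondConfig V`),
vertices `a, c` and vertex sets `X, X'` (two open-neighbourhood patterns of an extra terminal `b`, glued
to `X` resp. `X'`), with `R_a(X) = ⋃ x ∈ X, {a ↔ x}`:
`μ(B_X)·μ(C_{X'}) + μ(B_{X'})·μ(C_X) ≤ μ(A_X) + μ(A_{X'})`, where `B_X = R_a(X)` (`= {a ↔ b}`),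
`C_X = {a↔c} ∪ (R_a(X) ∩ R_c(X))` (`= {a ↔ c}` in `K + b`), `A_X = R_a(X) ∩ ({a↔c} ∪ R_c(X))` (`= {a↔b↔c}`).
The diagonal `X = X'` is Harris' inequality `μ{a↔b}·μ{a↔c} ≤ μ{a↔b↔c}`; the off-diagonal entries say
that the Harris slack is superadditive over the boundary law of `b`. [this work] -/
theorem crossHarris_terminal (w : Sym2 V → unitInterval) (a c : V) (X X' : Set V) :
    (prodBernoulli w).real (⋃ x ∈ X, (openConn a x : Set (BondConfig V))) *
        (prodBernoulli w).real ((openConn a c : Set (BondConfig V)) ∪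
          ((⋃ x ∈ X', (openConn a x : Set (BondConfig V))) ∩ (⋃ x ∈ X', (openConn c x : Set (BondConfig V))))) +
      (prodBernoulli w).real (⋃ x ∈ X', (openConn a x : Set (BondConfig V))) *
        (prodBernoulli w).real ((openConn a c : Set (BondConfig V)) ∪
          ((⋃ x ∈ X, (openConn a x : Set (BondConfig V))) ∩ (⋃ x ∈ X, (openConn c x : Set (BondConfig V))))) ≤
      (prodBernoulli w).real ((⋃ x ∈ X, (openConn a x : Set (BondConfig V))) ∩
          ((openConn a c : Set (BondConfig V)) ∪ (⋃ x ∈ X, (openConn c x : Set (BondConfig V))))) +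
        (prodBernoulli w).real ((⋃ x ∈ X', (openConn a x : Set (BondConfig V))) ∩
          ((openConn a c : Set (BondConfig V)) ∪ (⋃ x ∈ X', (openConn c x : Set (BondConfig V))))) := by
  set μ := prodBernoulli w with hμ
  set B : Set (BondConfig V) := ⋃ x ∈ X, (openConn a x : Set (BondConfig V)) with hBdef
  set B' : Set (BondConfig V) := ⋃ x ∈ X', (openConn a x : Set (BondConfig V)) with hB'def
  set C : Set (BondConfig V) := openConn a c with hCdef
  set E : Set (BondConfig V) := ⋃ x ∈ X, (openConn c x : Set (BondConfig V)) with hEdef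
  set E' : Set (BondConfig V) := ⋃ x ∈ X', (openConn c x : Set (BondConfig V)) with hE'def
  rw [real_inter_union_split μ B C E, real_inter_union_split μ B' C E',
    real_union_inter_split μ B' C E', real_union_inter_split μ B C E]
  have hB : IsUpperSet B := isUpperSet_reach a X
  have hB' : IsUpperSet B' := isUpperSet_reach a X'
  have hC : IsUpperSet C := isUpperSet_openConn a c
  have h1 : μ.real B * μ.real C ≤ μ.real (B ∩ C) :=
    prodBernoulli_harris w hB hC MeasurableSet.of_discrete MeasurableSet.of_discrete
  have h2 : μ.real B' * μ.real C ≤ μ.real (B' ∩ C) :=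
    prodBernoulli_harris w hB' hC MeasurableSet.of_discrete MeasurableSet.of_discrete
  exact cross_of_cells h1 h2 measureReal_le_one measureReal_le_one measureReal_nonneg measureReal_nonneg

/-- The algebraic core of the sharp form: if moreover `b' ≤ b` then the cross term dominates the Harris
slack of the first pattern. [this work] -/
theorem cross_of_cells_sharp {b b' k s' r r' : ℝ} (h2 : b' * k ≤ s') (hb : b ≤ 1) (hbb' : b' ≤ b)
    (hr : 0 ≤ r) (hr' : 0 ≤ r') :
    b * (k + r') + b' * (k + r) ≤ (s' + r') + b * (k + r) := by
  have h3 : b * r' ≤ r' := mul_le_of_le_one_left hr' hb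
  have h4 : b' * r ≤ b * r := mul_le_mul_of_nonneg_right hbb' hr
  nlinarith [h2, h3, h4]

/-- **Sharp form.**  If `μ(B_{X'}) ≤ μ(B_X)` (the terminal is at least as likely to be joined to `a` under the
pattern `X`), then `CH[X,X'] ≥ Har[X]`, i.e.
`μ(B_X)·μ(C_{X'}) + μ(B_{X'})·μ(C_X) ≤ μ(A_{X'}) + μ(B_X)·μ(C_X)`; together with the symmetric case this is
`CH[X,X'] ≥ min(Har[X], Har[X'])` (census for the random-cluster analogue: 0 / 7 410 crossing pairs and
0 / 103 adversarial climbs, `q ≤ 100`, memo §3.7). [this work] -/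
theorem crossHarris_terminal_sharp (w : Sym2 V → unitInterval) (a c : V) (X X' : Set V)
    (hXX' : (prodBernoulli w).real (⋃ x ∈ X', (openConn a x : Set (BondConfig V))) ≤
      (prodBernoulli w).real (⋃ x ∈ X, (openConn a x : Set (BondConfig V)))) :
    (prodBernoulli w).real (⋃ x ∈ X, (openConn a x : Set (BondConfig V))) *
        (prodBernoulli w).real ((openConn a c : Set (BondConfig V)) ∪
          ((⋃ x ∈ X', (openConn a x : Set (BondConfig V))) ∩ (⋃ x ∈ X', (openConn c x : Set (BondConfig V))))) +
      (prodBernoulli w).real (⋃ x ∈ X', (openConn a x : Set (BondConfig V))) *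
        (prodBernoulli w).real ((openConn a c : Set (BondConfig V)) ∪
          ((⋃ x ∈ X, (openConn a x : Set (BondConfig V))) ∩ (⋃ x ∈ X, (openConn c x : Set (BondConfig V))))) ≤
      (prodBernoulli w).real ((⋃ x ∈ X', (openConn a x : Set (BondConfig V))) ∩
          ((openConn a c : Set (BondConfig V)) ∪ (⋃ x ∈ X', (openConn c x : Set (BondConfig V))))) +
        (prodBernoulli w).real (⋃ x ∈ X, (openConn a x : Set (BondConfig V))) *
          (prodBernoulli w).real ((openConn a c : Set (BondConfig V)) ∪
            ((⋃ x ∈ X, (openConn a x : Set (BondConfig V))) ∩ (⋃ x ∈ X, (openConn c x : Set (BondConfig V))))) := by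
  set μ := prodBernoulli w with hμ
  set B : Set (BondConfig V) := ⋃ x ∈ X, (openConn a x : Set (BondConfig V)) with hBdef
  set B' : Set (BondConfig V) := ⋃ x ∈ X', (openConn a x : Set (BondConfig V)) with hB'def
  set C : Set (BondConfig V) := openConn a c with hCdef
  set E : Set (BondConfig V) := ⋃ x ∈ X, (openConn c x : Set (BondConfig V)) with hEdef
  set E' : Set (BondConfig V) := ⋃ x ∈ X', (openConn c x : Set (BondConfig V)) with hE'def
  rw [real_inter_union_split μ B' C E', real_union_inter_split μ B' C E', real_union_inter_split μ B C E]
  have hB' : IsUpperSet B' := isUpperSet_reach a X'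
  have hC : IsUpperSet C := isUpperSet_openConn a c
  have h2 : μ.real B' * μ.real C ≤ μ.real (B' ∩ C) :=
    prodBernoulli_harris w hB' hC MeasurableSet.of_discrete MeasurableSet.of_discrete
  exact cross_of_cells_sharp h2 measureReal_le_one hXX' measureReal_nonneg measureReal_nonneg

/-- The superadditivity / robustness form: for every finite family of patterns `pat k` with non-negative
weights `ψ k`, the Harris inequality holds for the `ψ`-mixture:
`(Σ_k ψ_k μ(B_k)) · (Σ_k ψ_k μ(C_k)) ≤ (Σ_k ψ_k μ(A_k)) · (Σ_k ψ_k)` — Harris' inequality for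
`{a↔b}, {a↔c}` survives an ARBITRARY non-negative potential on the star of the terminal `b`. [this work] -/
theorem harris_terminal_potential (w : Sym2 V → unitInterval) (a c : V) {κ : Type*} (S : Finset κ)
    (pat : κ → Set V) (ψ : κ → ℝ) (hψ : ∀ k ∈ S, 0 ≤ ψ k) :
    (∑ k ∈ S, ψ k * (prodBernoulli w).real (⋃ x ∈ pat k, (openConn a x : Set (BondConfig V)))) *
        (∑ k ∈ S, ψ k * (prodBernoulli w).real ((openConn a c : Set (BondConfig V)) ∪
          ((⋃ x ∈ pat k, (openConn a x : Set (BondConfig V))) ∩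
            (⋃ x ∈ pat k, (openConn c x : Set (BondConfig V)))))) ≤
      (∑ k ∈ S, ψ k * (prodBernoulli w).real ((⋃ x ∈ pat k, (openConn a x : Set (BondConfig V))) ∩
          ((openConn a c : Set (BondConfig V)) ∪ (⋃ x ∈ pat k, (openConn c x : Set (BondConfig V)))))) *
        (∑ k ∈ S, ψ k) := by
  -- abbreviations for the three cell functions of a pattern
  set fB : κ → ℝ := fun k => (prodBernoulli w).real (⋃ x ∈ pat k, (openConn a x : Set (BondConfig V)))
    with hfB
  set fC : κ → ℝ := fun k => (prodBernoulli w).real ((openConn a c : Set (BondConfig V)) ∪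
      ((⋃ x ∈ pat k, (openConn a x : Set (BondConfig V))) ∩ (⋃ x ∈ pat k, (openConn c x : Set (BondConfig V)))))
    with hfC
  set fA : κ → ℝ := fun k => (prodBernoulli w).real ((⋃ x ∈ pat k, (openConn a x : Set (BondConfig V))) ∩
      ((openConn a c : Set (BondConfig V)) ∪ (⋃ x ∈ pat k, (openConn c x : Set (BondConfig V)))))
    with hfA
  change (∑ k ∈ S, ψ k * fB k) * (∑ k ∈ S, ψ k * fC k) ≤ (∑ k ∈ S, ψ k * fA k) * (∑ k ∈ S, ψ k)
  rw [Finset.sum_mul_sum, Finset.sum_mul_sum]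
  have key : ∀ k ∈ S, ∀ l ∈ S,
      ψ k * fB k * (ψ l * fC l) + ψ l * fB l * (ψ k * fC k) ≤
        ψ k * fA k * ψ l + ψ l * fA l * ψ k := by
    intro k hk l hl
    have h : fB k * fC l + fB l * fC k ≤ fA k + fA l := crossHarris_terminal w a c (pat k) (pat l)
    have hkl : 0 ≤ ψ k * ψ l := mul_nonneg (hψ k hk) (hψ l hl)
    nlinarith [h, hkl]
  have hsum := Finset.sum_le_sum fun k hk => Finset.sum_le_sum fun l hl => key k hk l hl
  simp only [Finset.sum_add_distrib] at hsum
  have hswapL : ∑ k ∈ S, ∑ l ∈ S, ψ l * fB l * (ψ k * fC k) =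
      ∑ k ∈ S, ∑ l ∈ S, ψ k * fB k * (ψ l * fC l) := Finset.sum_comm
  have hswapR : ∑ k ∈ S, ∑ l ∈ S, ψ l * fA l * ψ k = ∑ k ∈ S, ∑ l ∈ S, ψ k * fA k * ψ l :=
    Finset.sum_comm
  rw [hswapL, hswapR] at hsum
  linarith

end CrossHarris

end Summit.CriticalPhenomena.PercolationContinuityZ3.Theorems
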